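import Literature.MathematicalPhysics.QuantumFieldTheory.Balaban1983to89.B8Thm2TorusAtOfLettersPerB9
import Literature.MathematicalPhysics.QuantumFieldTheory.Balaban1983to89.B8Thm2SetupTorus

/-!
# `Balaban1983to89.B8Thm2SetupTorusOfLettersPerB9` — [Balaban1985RegularSpaces] Theorem 2 (p. 83) on `Ω_j = T_η` AT THE `SU(N)`-VALUED SETUP-TORUS
# OBJECTS (`B8Thm2SetupTorus.Thm2SetupSUAt P N k η 0 B₁ B₂ c₁ len (fun _ => True)`, the sentence R3's P-V3-A row reads) FROM THE v3 [4] LETTERS ALONE —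
# the glue of the v3-b9 endpoint `B8Thm2TorusAtOfLettersPerB9.thm2TorusAt_specialUnitary_of_lettersPerB9` with the reading
# `B8Thm2SetupTorus.thm2SetupSUAt_of_thm2TorusAt` at the period `sitesPerDir 0 = 2·L^{m+K} ∈ Lᵏℤ` (`pow_dvd_period`)

statement-level skeleton of published theorems with citation tags; proofs where landed; nothing here is a claim about the
Yang–Mills mass gap

T. Bałaban, *Spaces of regular gauge field configurations on a lattice and gauge fixing conditions*, Commun. Math. Phys. **99** (1985) 75–102
`[Balaban1985RegularSpaces]` ("B8"): Thm 2 p. 83 with (1.33)–(1.39) pp. 82–83, p. 77 («Ω_j = T_η for j = 0,1,…,l, l ≤ k»), p. 76 (`G = SU(N)`), §3 p. 98;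
T. Bałaban, *Propagators for lattice gauge theories in a background field*, CMP **99** (1985) 389–434 `[Balaban1985BackgroundPropagators]` ("[4]"):
Thms 3.1–3.3 pp. 397–399 (the letters, on `T_η`).  STATUS: published, refereed.

CITATION HEADER (lean-in-tree rule).  Cell `lit-balaban`, seat `lit-balaban-t2s-1` (gen 3), sub-row «G-B8-T2S» (R3 `stmt-QuantumFields-19200`,
`--supports`), route P, the consumer-facing corollary of the v3-b9 endpoint.  WHAT IS PROVED (kernel, 0 sorry, no `def`): ★
**`thm2SetupSUAt_of_lettersPerB9`** — for a Setup-torus `P : Params` with `d, L ≥ 2`, `1 ≤ N ≤ 25`, the letters' constants with `5dLB₀ ≥ 2`,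
`3·(2dL²)·B_G·(B_R + 2) ≤ B₀′`, `c_{b9}, c_L > 0` and `B₁ > 5dLB₀(1 + 11d²)`: ONE pair `B₂, c₁ > 0` such that at every level `1 ≤ k ≤ m + K` and every
`η > 0`, GIVEN the v3 [4] letters `LettersAllPer (M_N ℂ) L B_G B_R B₀′ᴴ B₂′ B₀ B₀β c_{b9} β len c_L η k (sitesPerDir 0) SU(N)` with their `tr`-laws,
`Thm2SetupSUAt P N k η 0 B₁ B₂ c₁ len (fun _ => True)` holds — Theorem 2, both halves, for `SU(N)`-valued Setup-torus gauge fields, Hölder datum `β₀ = 0`,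
no extra regularity predicate.  PROOF: `thm2TorusAt_specialUnitary_of_lettersPerB9` at the period `P := sitesPerDir 0` (`Lᵏ ∣ sitesPerDir 0` for
`k ≤ m + K`, `B8Thm2SetupTorus.pow_dvd_period`), then `B8Thm2SetupTorus.thm2SetupSUAt_of_thm2TorusAt`.

HONEST SCOPE.  A two-line composition; Theorem 2 on `T_η` is a theorem MODULO THE v3 [4] LETTERS (displayed hypothesis `LettersAllPer …` +
`LettersAllPerTau …`, sub-row «G-B9-LETTERS», no supplier in tree yet) and the displayed numeric side conditions; count-neutral — N05 ∕ `stub_PV3A` NOT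
discharged by this file; nothing continuum ∕ ℝ⁴ ∕ OS ∕ mass-gap ∕ Clay — the Yang–Mills mass gap is NOT proved.  No `sorry`, no `def`, no `… : Prop` fact,
no `instance`, no `notation`.  Unit `lit-balaban-t2s-1` (g3), 2026-08-28.
-/

noncomputable section

open scoped BigOperators

namespace Literature.MathematicalPhysics.QuantumFieldTheory.Balaban1983to89.B8Thm2SetupTorusOfLettersPerB9

open B7Prop1Explicit renaming Site → LSite
open B7Prop2SpecialUnitary (specialUnitaryUnits)
open B8SpecialUnitaryTrace (trCLM)
open B8Thm2TorusLettersPer (LettersAllPer LettersAllPerTau)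
open B8Thm2SetupTorus (Thm2SetupSUAt thm2SetupSUAt_of_thm2TorusAt pow_dvd_period)
open B8Thm2TorusAtOfLettersPerB9 (thm2TorusAt_specialUnitary_of_lettersPerB9)

section SetupSU

open scoped Matrix.Norms.L2Operator

variable {P : Params} {N : ℕ} [NeZero N]

/-- ★ **THEOREM 2 ON `T_η` AT THE `SU(N)`-VALUED SETUP-TORUS OBJECTS, FROM THE v3 [4] LETTERS ALONE** (`1 ≤ N ≤ 25`, `d, L ≥ 2`): ONE pair `B₂, c₁ > 0`
(from `d, L`, the letters' constants and `B₁` only — p. 83 «absolute constants depending on d and L only») such that at every level `1 ≤ k ≤ m + K` and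
every `η > 0`, the v3 letters at the period `sitesPerDir 0` with their `tr`-laws give `Thm2SetupSUAt P N k η 0 B₁ B₂ c₁ len (fun _ => True)`.
[cite: Balaban1985RegularSpaces, Thm 2 p.83, (1.33)–(1.39) pp.82–83, p.77 («Ω_j = T_η»), p.76 («G = SU(N)»), §3 p.98; Balaban1985BackgroundPropagators, Thms 3.1–3.3 pp.397–399] -/
theorem thm2SetupSUAt_of_lettersPerB9 (hN : N ≤ 25) (hd2 : 2 ≤ P.d) (hL : 2 ≤ P.L)
    {B₀ B₀' B₀'H B₂' BG BR B₀β cB9 β cL B₁ : ℝ} {len : LSite P.d → ℝ}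
    (hB₀ : 0 < B₀) (hB₀' : 0 < B₀') (hB : 2 ≤ 5 * (P.d : ℝ) * P.L * B₀) (hB₀'H : 0 < B₀'H) (hB₂' : 0 ≤ B₂') (hBG : 0 ≤ BG) (hBR : 0 ≤ BR)
    (hcB9 : 0 < cB9) (hcL : 0 < cL) (hfree : 3 * (2 * (P.d : ℝ) * (P.L : ℝ) ^ 2) * BG * (BR + 2) ≤ B₀')
    (hB₁ : 5 * (P.d : ℝ) * P.L * B₀ * (1 + 11 * (P.d : ℝ) ^ 2) < B₁) :
    letI : CStarAlgebra (Matrix (Fin N) (Fin N) ℂ) := {}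
    ∃ B₂ c₁ : ℝ, 0 < B₂ ∧ 0 < c₁ ∧ ∀ (k : ℕ) (η : ℝ), 1 ≤ k → k ≤ P.m + P.K → 0 < η →
      ∀ ℓP : LettersAllPer (𝔸 := Matrix (Fin N) (Fin N) ℂ) P.L BG BR B₀'H B₂' B₀ B₀β cB9 β len cL η k (((P.sitesPerDir 0 : ℕ) : ℤ))
          (specialUnitaryUnits (Fin N)),
        LettersAllPerTau (𝔸 := Matrix (Fin N) (Fin N) ℂ) (trCLM (Fin N)) ℓP →
      Thm2SetupSUAt P N k η 0 B₁ B₂ c₁ len (fun _ => True) := by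
  letI : CStarAlgebra (Matrix (Fin N) (Fin N) ℂ) := {}
  obtain ⟨B₂, c₁, hB₂, hc₁, H⟩ :=
    thm2TorusAt_specialUnitary_of_lettersPerB9 (len := len) hN hd2 hL hB₀ hB₀' hB hB₀'H hB₂' hBG hBR hcB9 hcL hfree hB₁
  refine ⟨B₂, c₁, hB₂, hc₁, fun k η hk hkK hη ℓP ℓPτ => thm2SetupSUAt_of_thm2TorusAt ?_⟩
  exact H k _ η hk hη (pow_dvd_period P (j := 0) (by omega)) ℓP ℓPτ

end SetupSU

end Literature.MathematicalPhysics.QuantumFieldTheory.Balaban1983to89.B8Thm2SetupTorusOfLettersPerB9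

end
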